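import Summits.BirchSwinnertonDyer.BirchSwinnertonDyer.Theorems.BiquadraticEisensteinDescentHeegnerTwistCouplingInSupplySqrtSevenCell
import HarnessLib

set_option linter.dupNamespace false -- `Summit.BirchSwinnertonDyer.BirchSwinnertonDyer.Theorems.…` (summit = sub)
set_option autoImplicit false

/-!
# Crux `HeegnerTwistCouplingInSupply` (stmt-BirchSwinnertonDyer-21381) — the `j = −3375` family, the `q`-free sub-cell (Coates–Li–Tian–Zhai's `R`):
# `A_R : y² = x³ + 21R x² + 112R² x` (`= X₀(49)^{(R)}`) for `R ≥ 1` square-free with EVERY prime factor `≡ 1 (mod 4)` and inert in `ℚ(√−7)`: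
# `S ⊆ {1, 7}`, `S′ ⊆ {1, −7}`, `rank A_R(ℚ) = 0`, `Ш(A_R/ℚ)[2] = 0`, `corank_{ℤ₂} Sel_{2^∞}(A_R/ℚ) = 0` — UNCONDITIONAL

Route `BiquadraticEisensteinDescent` (cell `pub/bsd-wall`, width seat `bsd-wall-cm-bed-w1` g11; `--supports` 21381, helper). Companion of `…SqrtSevenCell`
(CELL-√7: `n = q·m` with ONE prime `q ≡ 3 (mod 8)`); here the case WITHOUT `q`: `n = R`, all prime factors `r ≡ 1 (mod 4)` with `(r/7) = −1` — exactly the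
`R = q₁⋯q_r` of Coates–Li–Tian–Zhai 2015 Thm. 1.2 («`L(A^{(R)}, 1) ≠ 0`, `A^{(R)}(ℚ)` is finite, `Ш` finite of odd cardinality, full BSD», PRINT; typed as the named
fact `CoatesLiTianZhai2015.thm12_fullBSD_twist`). This file PROVES the algebraic half of that theorem by the tree's `2`-isogeny descent (no `L`-values):

* §1 the `2`-adic residues (mod `16`, `decide`) of the classes `2`, `14` of `S(21R, 112R²)` for `R ≡ 1 (mod 4)`;
* §2 ★ `mem_twoIsogenySelmerGroup_phiHat_R` (**`S(21R,112R²) ⊆ {1,7}`**: `ℝ`, `r`-adic via `(−7/r) = −1`, `2`-adic for `2, 14`), ★ `mem_twoIsogenySelmerGroup_phi_R`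
  (**`S(−42R,−7R²) ⊆ {1,−7}`**: `r`-adic via `(7/r) = −1`, `7`-adic for `−1, 7`);
* §3 ★ `rank_eq_zero_and_sha_two_R`, ★ `selmerCorank_two_eq_zero_R`; ★ `rank_eq_zero_prime_twist` — **`rank X₀(49)^{(ℓ)}(ℚ) = 0 ∧ Ш[2] = 0` for EVERY prime
  `ℓ ≡ 1 (mod 4)` inert in `ℚ(√−7)`** (`ℓ ≡ 5, 13, 17 (mod 28)`).

Numerics (seat folder, `n ≤ 1200`): sharp in `100 %` (residue multisets `(1)`, `(5)`, `(1,1)`, `(1,5)`, `(5,5)`, `(1,5,5)`: 73/73). HONEST FRAMING: unconditional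
arithmetic of one explicit CM family; `L(A_R, 1) ≠ 0` itself stays print (CLTZ) or follows modulo Burungale–Tian + Deuring–Hecke as in `…SqrtSevenCorner`;
nothing about the crux (C⁺) or BSD is proved. THEOREMS ONLY.
-/

noncomputable section

open scoped Classical

namespace Summit.BirchSwinnertonDyer.BirchSwinnertonDyer.Theorems.BiquadraticEisensteinDescentHeegnerTwistCouplingInSupplySqrtSevenCellR

open _root_.WeierstrassCurve Literature.NumberTheory.EllipticCurves
open Summit.BirchSwinnertonDyer.BirchSwinnertonDyer.Theorems.GoldfeldGoodTwists
  (not_isSoluble_two_of_zmodPow not_isSoluble_real_twoIsogenyQuartic_of_neg_of_sq_lt not_isSoluble_padic_of_nonresidue_of_prime_dvd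
    mordellWeilRank_congr forall_mem_sha_two_congr hab_posTwist rank_eq_zero_and_sha_two_of_card_le_two)
open Summit.BirchSwinnertonDyer.BirchSwinnertonDyer.Theorems.BiquadraticEisensteinDescentHeegnerTwistCouplingInSupplySqrtSevenLocal
open Summit.BirchSwinnertonDyer.BirchSwinnertonDyer.Theorems.BiquadraticEisensteinDescentHeegnerTwistCouplingInSupplySqrtSevenCell

/-! ## §1 The `2`-adic residues of the classes `2`, `14` of `S(21R, 112R²)`, `R ≡ 1 (mod 4)` -/

section TwoAdic

/-- Residues modulo `16` for the class `2` (`w² = 2u⁴ + 21R u²z² + 56R² z⁴`, `R = 4N + 1`): both charts insoluble. [folklore] -/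
theorem zmod_key_two : ∀ N T S : ZMod (2 ^ 4),
    S ^ 2 ≠ 2 + 21 * (4 * N + 1) * T ^ 2 + 56 * (4 * N + 1) ^ 2 * T ^ 4 ∧
    S ^ 2 ≠ 56 * (4 * N + 1) ^ 2 + 21 * (4 * N + 1) * T ^ 2 + 2 * T ^ 4 := by
  decide

/-- Residues modulo `16` for the class `14` (`w² = 14u⁴ + 21R u²z² + 8R² z⁴`, `R = 4N + 1`): both charts insoluble. [folklore] -/
theorem zmod_key_fourteen : ∀ N T S : ZMod (2 ^ 4),
    S ^ 2 ≠ 14 + 21 * (4 * N + 1) * T ^ 2 + 8 * (4 * N + 1) ^ 2 * T ^ 4 ∧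
    S ^ 2 ≠ 8 * (4 * N + 1) ^ 2 + 21 * (4 * N + 1) * T ^ 2 + 14 * T ^ 4 := by
  decide

variable {R : ℕ}

/-- The class `2` of `S(21R, 112R²)` has no `ℚ₂`-point (`R ≡ 1 (mod 4)`). [cite: SilvermanAEC2009, Prop. X.4.9] -/
theorem not_isSoluble_two_two (hR4 : R % 4 = 1) :
    ¬ ((twoIsogenyQuartic (21 * (R : ℤ)) 2 (56 * (R : ℤ) ^ 2)).map (Int.castRingHom ℚ_[2])).IsSoluble := by
  obtain ⟨N, rfl⟩ : ∃ N, R = 4 * N + 1 := ⟨R / 4, by omega⟩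
  refine not_isSoluble_two_of_zmodPow 4 4 (fun T S => ?_) (fun T S => ?_)
  · have := (zmod_key_two (N : ZMod (2 ^ 4)) T S).1; push_cast; convert this using 2
  · have := (zmod_key_two (N : ZMod (2 ^ 4)) T S).2; push_cast; convert this using 2

/-- The class `14` of `S(21R, 112R²)` has no `ℚ₂`-point (`R ≡ 1 (mod 4)`). [cite: SilvermanAEC2009, Prop. X.4.9] -/
theorem not_isSoluble_two_fourteen (hR4 : R % 4 = 1) :
    ¬ ((twoIsogenyQuartic (21 * (R : ℤ)) 14 (8 * (R : ℤ) ^ 2)).map (Int.castRingHom ℚ_[2])).IsSoluble := by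
  obtain ⟨N, rfl⟩ : ∃ N, R = 4 * N + 1 := ⟨R / 4, by omega⟩
  refine not_isSoluble_two_of_zmodPow 4 4 (fun T S => ?_) (fun T S => ?_)
  · have := (zmod_key_fourteen (N : ZMod (2 ^ 4)) T S).1; push_cast; convert this using 2
  · have := (zmod_key_fourteen (N : ZMod (2 ^ 4)) T S).2; push_cast; convert this using 2

end TwoAdic

/-! ## §2 The two Selmer sets of `A_R` -/

section Selmer

variable {R : ℕ} (hR0 : 0 < R) (hRsq : Squarefree R)
  (hR : ∀ r : ℕ, r.Prime → r ∣ R → r % 4 = 1 ∧ (r % 7 = 3 ∨ r % 7 = 5 ∨ r % 7 = 6))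
include hR0 hRsq hR

/-- ★ **`S(21R, 112R²) ⊆ {1, 7}`**: a negative class dies over `ℝ`, a class through a prime of `R` dies there (`(−7/r) = −1`), `2` and `14` die at `2`
(`R ≡ 1 (mod 4)`). [cite: SilvermanAEC2009, Prop. X.4.9 and Example X.4.10] -/
theorem mem_twoIsogenySelmerGroup_phiHat_R {d : ℤ} (h : d ∈ twoIsogenySelmerGroup (21 * (R : ℤ)) (112 * (R : ℤ) ^ 2)) : d = 1 ∨ d = 7 := by
  have hR4 : R % 4 = 1 := mod_four_eq_one_of_prime_factors hR0 fun r hr hd => (hR r hr hd).1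
  have hn0' : (R : ℤ) ≠ 0 := by exact_mod_cast hR0.ne'
  have hb : (112 * (R : ℤ) ^ 2 : ℤ) ≠ 0 := by positivity
  obtain ⟨hsq, hdvd, hloc⟩ := (mem_twoIsogenySelmerGroup_iff hb).mp h
  have hmul : d * (112 * (R : ℤ) ^ 2 / d) = 112 * (R : ℤ) ^ 2 := Int.mul_ediv_cancel' hdvd
  have hdpos : 0 < d := by
    by_contra hle
    have hd0 : d < 0 := lt_of_le_of_ne (not_lt.mp hle) hsq.ne_zero
    refine not_isSoluble_real_twoIsogenyQuartic_of_neg_of_sq_lt hd0 ?_ hloc.1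
    rw [hmul]; nlinarith [sq_pos_of_ne_zero hn0']
  by_cases hodd : ∃ r : ℕ, r.Prime ∧ r ≠ 2 ∧ r ≠ 7 ∧ (r : ℤ) ∣ d
  · obtain ⟨r, hr, hr2, hr7, hrd⟩ := hodd
    exfalso
    haveI : Fact r.Prime := ⟨hr⟩
    have hrZ : Prime (r : ℤ) := Nat.prime_iff_prime_int.mp hr
    have hrn : r ∣ R := by
      rcases hrZ.dvd_or_dvd (hrd.trans hdvd) with h112 | hn2
      · exfalso
        have h' : r ∣ 2 ^ 4 * 7 := by exact_mod_cast h112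
        rcases (Nat.Prime.dvd_mul hr).mp h' with h2 | h7
        · exact hr2 ((Nat.prime_dvd_prime_iff_eq hr Nat.prime_two).mp (hr.dvd_of_dvd_pow h2))
        · exact hr7 ((Nat.prime_dvd_prime_iff_eq hr (by norm_num)).mp h7)
      · exact_mod_cast hrZ.dvd_of_dvd_pow hn2
    exact not_isSoluble_padic_phiHat_of_prime_dvd hRsq hrn
      (not_isSquare_seven_and_neg_seven_of_mod_four_eq_one (hR r hr hrn).1 (hR r hr hrn).2).2 hsq hrd hdvd (hloc.2 r)
  · push Not at hodd
    have habs := natAbs_mem_of_squarefree hsq fun r hr hrd => by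
      by_contra hne; push Not at hne; exact hodd r hr hne.1 hne.2 hrd
    have hd' : d = 1 ∨ d = 2 ∨ d = 7 ∨ d = 14 := by omega
    rcases hd' with rfl | rfl | rfl | rfl
    · exact Or.inl rfl
    · exfalso
      have h2 := hloc.2 2
      rw [Int.ediv_eq_of_eq_mul_right (by norm_num) (show (112 * (R : ℤ) ^ 2 : ℤ) = 2 * (56 * (R : ℤ) ^ 2) by ring)] at h2
      exact not_isSoluble_two_two hR4 h2
    · exact Or.inr rfl
    · exfalso
      have h2 := hloc.2 2
      rw [Int.ediv_eq_of_eq_mul_right (by norm_num) (show (112 * (R : ℤ) ^ 2 : ℤ) = 14 * (8 * (R : ℤ) ^ 2) by ring)] at h2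
      exact not_isSoluble_two_fourteen hR4 h2

/-- ★ **`S(−42R, −7R²) ⊆ {1, −7}`**: a class through a prime of `R` dies there (`(7/r) = −1`), `−1` and `7` die at `7` (`(−1/7) = −1`, `7 ∥ 7R²`).
[cite: SilvermanAEC2009, Prop. X.4.9 and Example X.4.10] -/
theorem mem_twoIsogenySelmerGroup_phi_R {d : ℤ} (h : d ∈ twoIsogenySelmerGroup (-42 * (R : ℤ)) (-7 * (R : ℤ) ^ 2)) : d = 1 ∨ d = -7 := by
  haveI : Fact (Nat.Prime 7) := ⟨by norm_num⟩
  have h7n : ¬ 7 ∣ R := fun h7 => by have := (hR 7 (by norm_num) h7).2; omega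
  have hn0' : (R : ℤ) ≠ 0 := by exact_mod_cast hR0.ne'
  have hb : (-7 * (R : ℤ) ^ 2 : ℤ) ≠ 0 := by
    have : (0 : ℤ) < (R : ℤ) ^ 2 := by positivity
    linarith
  have h7Z : Prime (7 : ℤ) := Int.prime_iff_natAbs_prime.mpr (by norm_num)
  have h7nZ : ¬ (7 : ℤ) ∣ (R : ℤ) := by exact_mod_cast h7n
  have h7n2 : ¬ (7 : ℤ) ∣ (R : ℤ) ^ 2 := fun h => h7nZ (h7Z.dvd_of_dvd_pow h)
  obtain ⟨hsq, hdvd, hloc⟩ := (mem_twoIsogenySelmerGroup_iff hb).mp h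
  by_cases hodd : ∃ r : ℕ, r.Prime ∧ r ∣ R ∧ (r : ℤ) ∣ d
  · obtain ⟨r, hr, hrm, hrd⟩ := hodd
    exfalso
    haveI : Fact r.Prime := ⟨hr⟩
    exact not_isSoluble_padic_phi_of_prime_dvd (by have := (hR r hr hrm).1; omega) hRsq hrm
      (not_isSquare_seven_and_neg_seven_of_mod_four_eq_one (hR r hr hrm).1 (hR r hr hrm).2).1 hsq hrd hdvd (hloc.2 r)
  · push Not at hodd
    -- every prime factor of `d` is `7`
    have habs : d.natAbs = 1 ∨ d.natAbs = 2 ∨ d.natAbs = 7 ∨ d.natAbs = 14 := natAbs_mem_of_squarefree hsq fun r hr hrd => by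
      have hrZ : Prime (r : ℤ) := Nat.prime_iff_prime_int.mp hr
      rcases hrZ.dvd_or_dvd (hrd.trans hdvd) with h7 | hn2
      · right
        have h' : (r : ℤ) ∣ ((7 : ℕ) : ℤ) := by simpa using h7
        exact (Nat.prime_dvd_prime_iff_eq hr (by norm_num)).mp (Int.natCast_dvd_natCast.mp h')
      · have hrn : r ∣ R := by exact_mod_cast hrZ.dvd_of_dvd_pow hn2
        exact absurd hrd (hodd r hr hrn)
    have h2d : ¬ (2 : ℤ) ∣ d := fun h2 => by
      have : (2 : ℤ) ∣ -7 * (R : ℤ) ^ 2 := h2.trans hdvd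
      have hR2 : ¬ 2 ∣ R := fun h => by have := (hR 2 Nat.prime_two h).1; omega
      rcases Int.prime_two.dvd_or_dvd this with h | h
      · norm_num at h
      · exact hR2 (by exact_mod_cast Int.prime_two.dvd_of_dvd_pow h)
    have hcases : d = 1 ∨ d = -1 ∨ d = 7 ∨ d = -7 := by omega
    have hcomm := fun (x y : ℤ) => isSoluble_map_twoIsogenyQuartic_comm (Int.castRingHom ℚ_[7]) (-42 * (R : ℤ)) x y
    rcases hcases with rfl | rfl | rfl | rfl
    · exact Or.inl rfl
    · exfalso
      have h7 := hloc.2 7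
      rw [show (-7 * (R : ℤ) ^ 2 : ℤ) / -1 = 7 * (R : ℤ) ^ 2 by rw [Int.ediv_neg, Int.ediv_one]; ring] at h7
      exact not_isSoluble_padic_of_nonresidue_of_prime_dvd (p := 7) (c := -6 * (R : ℤ)) (e' := (R : ℤ) ^ 2)
        (by push_cast; ring) (by push_cast; ring) h7n2
        (by rintro ⟨r, hr⟩; push_cast at hr; exact (zmod_seven_nonresidues r).2.2.2 hr.symm) h7
    · exfalso
      have h7 := hloc.2 7
      rw [Int.ediv_eq_of_eq_mul_right (by norm_num) (show (-7 * (R : ℤ) ^ 2 : ℤ) = 7 * (-((R : ℤ) ^ 2)) by ring), hcomm] at h7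
      exact not_isSoluble_padic_of_nonresidue_of_prime_dvd (p := 7) (c := -6 * (R : ℤ)) (e' := 1)
        (by push_cast; ring) (by norm_num) (by norm_num) (not_isSquare_neg_sq_zmod_seven h7nZ) h7
    · exact Or.inr rfl

/-- `#S(21R, 112R²) ≤ 2` on the sub-cell. [cite: SilvermanAEC2009, Prop. X.4.9] -/
theorem card_twoIsogenySelmerGroup_R_le : (twoIsogenySelmerGroup (21 * (R : ℤ)) (112 * (R : ℤ) ^ 2)).card ≤ 2 :=
  le_trans (Finset.card_le_card fun d hd => by
    have := mem_twoIsogenySelmerGroup_phiHat_R hR0 hRsq hR hd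
    simp only [Finset.mem_insert, Finset.mem_singleton]
    exact this) (Finset.card_le_two (a := (1 : ℤ)) (b := 7))

/-- `#S′(21R, 112R²) ≤ 2` on the sub-cell. [cite: SilvermanAEC2009, Prop. X.4.9] -/
theorem card_twoIsogenySelmerGroup'_R_le : (twoIsogenySelmerGroup' (21 * (R : ℤ)) (112 * (R : ℤ) ^ 2)).card ≤ 2 := by
  rw [twoIsogenySelmerGroup'_A]
  exact le_trans (Finset.card_le_card fun d hd => by
    have := mem_twoIsogenySelmerGroup_phi_R hR0 hRsq hR hd
    simp only [Finset.mem_insert, Finset.mem_singleton]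
    exact this) (Finset.card_le_two (a := (1 : ℤ)) (b := -7))

end Selmer

/-! ## §3 `rank A_R(ℚ) = 0`, `Ш(A_R/ℚ)[2] = 0`, `corank_{ℤ₂} Sel_{2^∞}(A_R/ℚ) = 0`; prime twists -/

section RankZero

variable {R : ℕ} (hR0 : 0 < R) (hRsq : Squarefree R)
  (hR : ∀ r : ℕ, r.Prime → r ∣ R → r % 4 = 1 ∧ (r % 7 = 3 ∨ r % 7 = 5 ∨ r % 7 = 6))
include hR0 hRsq hR

/-- ★ **`rank A_R(ℚ) = 0` and `Ш(A_R/ℚ)[2] = 0`** for `A_R : y² = x³ + 21R x² + 112R² x`, `R ≥ 1` square-free with every prime factor `≡ 1 (mod 4)` and inert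
in `ℚ(√−7)` — UNCONDITIONAL (the algebraic half of Coates–Li–Tian–Zhai 2015 Thm. 1.2, by `2`-isogeny descent).
[cite: SilvermanAEC2009, Thm. X.4.2(a), Prop. X.4.9] [cite: CoatesLiTianZhai2015, Thm. 1.2] -/
theorem rank_eq_zero_and_sha_two_R :
    (⟨0, 21 * (R : ℚ), 0, 112 * (R : ℚ) ^ 2, 0⟩ : WeierstrassCurve ℚ).mordellWeilRank = 0 ∧
      ∀ c ∈ (⟨0, 21 * (R : ℚ), 0, 112 * (R : ℚ) ^ 2, 0⟩ : WeierstrassCurve ℚ).sha, 2 • c = 0 → c = 0 := by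
  have hab := hab_posTwist (M := (R : ℤ)) (by exact_mod_cast hR0.ne')
  haveI := isElliptic_halfModel hab
  haveI := isElliptic_mk_of_ne_zero (F := ℚ) hab
  haveI := isElliptic_A hR0.ne'
  have h := rank_eq_zero_and_sha_two_of_card_le_two hab (card_twoIsogenySelmerGroup_R_le hR0 hRsq hR)
    (card_twoIsogenySelmerGroup'_R_le hR0 hRsq hR)
  refine ⟨?_, forall_mem_sha_two_congr (lit_A R).symm h.2⟩
  rw [← mordellWeilRank_congr (lit_A R)]
  exact h.1

/-- ★ **Corank form: `corank_{ℤ₂} Sel_{2^∞}(A_R/ℚ) = 0`** (hypothesis of Burungale–Tian's rank-zero `2`-converse). [cite: SilvermanAEC2009, Thm. X.4.2(a)] [cite: Greenberg1999, §1] -/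
theorem selmerCorank_two_eq_zero_R [hE : (⟨0, 21 * (R : ℚ), 0, 112 * (R : ℚ) ^ 2, 0⟩ : WeierstrassCurve ℚ).IsElliptic] :
    (⟨0, 21 * (R : ℚ), 0, 112 * (R : ℚ) ^ 2, 0⟩ : WeierstrassCurve ℚ).selmerCorank 2 = 0 := by
  haveI : Fact (Nat.Prime 2) := ⟨Nat.prime_two⟩
  obtain ⟨hr, hsha⟩ := rank_eq_zero_and_sha_two_R hR0 hRsq hR
  rw [(⟨0, 21 * (R : ℚ), 0, 112 * (R : ℚ) ^ 2, 0⟩ : WeierstrassCurve ℚ).selmerCorank_eq_mordellWeilRank_add_holds 2, hr,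
    (⟨0, 21 * (R : ℚ), 0, 112 * (R : ℚ) ^ 2, 0⟩ : WeierstrassCurve ℚ).shaCorank_eq_zero_of_forall 2 hsha]

end RankZero

/-- ★ **Prime twists: `rank X₀(49)^{(ℓ)}(ℚ) = 0` and `Ш[2] = 0` for EVERY prime `ℓ ≡ 1 (mod 4)` inert in `ℚ(√−7)`** (`ℓ ≡ 5, 13, 17 (mod 28)`; model
`A_ℓ = ⟨0, 21ℓ, 0, 112ℓ², 0⟩`) — UNCONDITIONAL. [cite: SilvermanAEC2009, Thm. X.4.2(a), Prop. X.4.9] [cite: CoatesLiTianZhai2015, Thm. 1.2 (r = 1)] -/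
theorem rank_eq_zero_prime_twist {ℓ : ℕ} (hℓ : ℓ.Prime) (hℓ4 : ℓ % 4 = 1) (hℓ7 : ℓ % 7 = 3 ∨ ℓ % 7 = 5 ∨ ℓ % 7 = 6) :
    (⟨0, 21 * (ℓ : ℚ), 0, 112 * (ℓ : ℚ) ^ 2, 0⟩ : WeierstrassCurve ℚ).mordellWeilRank = 0 ∧
      ∀ c ∈ (⟨0, 21 * (ℓ : ℚ), 0, 112 * (ℓ : ℚ) ^ 2, 0⟩ : WeierstrassCurve ℚ).sha, 2 • c = 0 → c = 0 :=
  rank_eq_zero_and_sha_two_R hℓ.pos hℓ.squarefree fun r hr hrd => by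
    obtain rfl := (Nat.prime_dvd_prime_iff_eq hr hℓ).mp hrd; exact ⟨hℓ4, hℓ7⟩

end Summit.BirchSwinnertonDyer.BirchSwinnertonDyer.Theorems.BiquadraticEisensteinDescentHeegnerTwistCouplingInSupplySqrtSevenCellR

end
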